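import Summits.CriticalPhenomena.PercolationContinuityZ3.Theorems.PercNearOneGluingNoHeavyConstsClusterSquareTwoTreeGraph
import Summits.CriticalPhenomena.PercolationContinuityZ3.Theorems.PercNearOneGluingNoHeavyConstsClusterSquareSeriesParallel
import HarnessLib

/-!
# TS on weighted partial 2-trees (series-parallel graphs in an elimination order) — syntactic hypotheses

builds on p205010 (kernel theorem, internal audit signed; external expert review pending)

PAPER-2 track "percolation constants", part (ii), seat `prim-consts-1`, gen 23 (lane index
`run/shared/lean/prim/consts/CONSTANTS.md`, row A19; memo `FROM-prim-consts-1-g23-SERIES-PARALLEL.md` §2(ii)).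
Support file for the crux `NoHeavyLowerTail` (stmt-CriticalPhenomena-4575; `--supports`).  Theorems only; no definitions, no sorries.

**`Consts.tripleSplit_partialTwoTree`**: TS `μ(a↮b, a↮c, b↮c)² ≤ μ(a↮b) μ(a↮c) μ(b↮c)` for ALL `a, b, c` and every weight vector on `Fin n`
whose positive pairs `{u < w}` satisfy `u ∈ {p₁ w, p₂ w}` for compatible parent maps `p₁ p₂ : Fin n → Fin n` (distinct parents `p₁ w, p₂ w < w`
have the smaller a parent of the larger) — a purely SYNTACTIC hypothesis: `K_{2,m}` (`p₁ ≡ 0`, `p₂ ≡ 1`), fans and squares of paths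
(`p₁ w = w−1`, `p₂ w = w−2`), every 2-tree in its construction order.  Assembly of `Consts.noK4Minor_of_partialTwoTree`
(`…TwoTreeGraph.lean`) with `Consts.tripleSplit_of_noK4Minor` (`…SeriesParallel.lean`).
References: R. J. Duffin, J. Math. Anal. Appl. 10 (1965) 303–318; J. A. Wald, C. J. Colbourn, Networks 13 (1983) 159–167; N. Gladkov,
arXiv:2408.08457v2 (2024), Thm. 4.3, Thm. 5.2, Cor. 5.3.
-/

noncomputable section

namespace Summit.CriticalPhenomena.PercolationContinuityZ3.Theorems

open MeasureTheory Literature.Probability.LatticeModels Literature.Probability.Percolation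

namespace Consts

/-! ### TS on weighted partial 2-trees -/

/-- **TS on every weighted partial 2-tree (series-parallel graph in an elimination order).**  Let `p₁ p₂ : Fin n → Fin n` be
compatible parent maps (distinct parents `p₁ w, p₂ w < w` have the smaller a parent of the larger) and let `w` be a weight vector
all of whose positive pairs `{u, v}`, `u < v`, satisfy `u = p₁ v ∨ u = p₂ v`.  Then for ALL vertices `a, b, c`:
`μ(a↮b, a↮c, b↮c)² ≤ μ(a↮b) · μ(a↮c) · μ(b↮c)` (`μ = prodBernoulli w`).  Examples: `K_{2,m}` (`p₁ ≡ 0`, `p₂ ≡ 1`), fans and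
squares of paths (`p₁ w = w−1`, `p₂ w = w−2`), every 2-tree with its construction order.
[cite: Gladkov2024, Thm. 5.2, Cor. 5.3 (pattern) and Thm. 4.3; Duffin1965, Thm. 1] -/
theorem tripleSplit_partialTwoTree (n : ℕ) (w : Sym2 (Fin n) → unitInterval) (p₁ p₂ : Fin n → Fin n)
    (hT : ∀ v : Fin n, p₁ v < v → p₂ v < v → p₁ v ≠ p₂ v →
      (p₁ v < p₂ v ∧ (p₁ v = p₁ (p₂ v) ∨ p₁ v = p₂ (p₂ v))) ∨ (p₂ v < p₁ v ∧ (p₂ v = p₁ (p₁ v) ∨ p₂ v = p₂ (p₁ v))))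
    (hw : ∀ u v : Fin n, u < v → (0 : ℝ) < w s(u, v) → u = p₁ v ∨ u = p₂ v) (a b c : Fin n) :
    (prodBernoulli w).real ((openConn a b)ᶜ ∩ (openConn a c)ᶜ ∩ (openConn b c)ᶜ) ^ 2 ≤
      (prodBernoulli w).real (openConn a b)ᶜ * (prodBernoulli w).real (openConn a c)ᶜ *
        (prodBernoulli w).real (openConn b c)ᶜ := by
  let H : SimpleGraph (Fin n) := SimpleGraph.fromRel fun u v => (0 : ℝ) < w s(u, v)
  have hH : ∀ u v, u ≠ v → (0 : ℝ) < w s(u, v) → H.Adj u v := fun u v huv hw' =>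
    (SimpleGraph.fromRel_adj _ u v).2 ⟨huv, Or.inl hw'⟩
  have hH' : ∀ u v, H.Adj u v → (0 : ℝ) < w s(u, v) := by
    intro u v huv
    rcases (SimpleGraph.fromRel_adj _ u v).1 huv with ⟨_, e | e⟩
    · exact e
    · rwa [Sym2.eq_swap] at e
  exact tripleSplit_of_noK4Minor w a b c H hH
    (noK4Minor_of_partialTwoTree p₁ p₂ hT H fun u v huv hlt => hw u v hlt (hH' u v huv))

end Consts

end Summit.CriticalPhenomena.PercolationContinuityZ3.Theorems
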